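import Summits.KontsevichZagierPeriods.Zeta5Search.Certificates.RayH1DualWindowE0
import Summits.KontsevichZagierPeriods.Zeta5Search.Certificates.RayH1DualSeries
import Summits.KontsevichZagierPeriods.Zeta5Search.Certificates.RecordRayDualSeriesFinal
import HarnessLib

/-!
# ζ(5) search — certificates: the dual series of the ray RayH1 (`e = 0`) — the exponential RATE of `F̃₇/Z`
(cell `pub-zeta5`, P1 g11; port of certifier 2's `RecordRayDualSeriesFinal`, upper half)

HONEST FRAMING: systematic search; no irrationality claim unless certified.

OUR work (Summit side). With `Z = termNorm (34n) (BH1E 0 n)` and `T̂ = termHat`: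
Stirling on the term, the window bound `T̂(μ) ≤ W_n` on the window, unimodality (every `T̂(μ) ≤ W_n`), the tail
`T̂(μ) ≤ W_n((n+1)/(μ+1))²` beyond `μ ≥ n`, partial sums `≤ 2(n+1)W_n`, hence `F̃₇ ≤ Z·2(n+1)·W_n` and
**`eventually_vwpDual_h1E0_le_exp`: for every `ε > 0`, eventually `F̃₇(natB (34n) (BH1E 0 n)) ≤ Z·e^{(-105.7485 + ε)n}`**
(model `sup ĥ = -105.75182`).
-/

noncomputable section

open Finset Real Filter Topology

namespace Summit.KontsevichZagierPeriods.Zeta5Search.RayH1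

open Summit.KontsevichZagierPeriods.Zeta5Search.DualSeries
open Summit.KontsevichZagierPeriods.Zeta5Search.DualSeriesBounds
open Summit.KontsevichZagierPeriods.Zeta5Search.RecordRay (ent log_choose_le_ent ent_le_log_choose eventually_log_linear_le)
open Literature.NumberTheory.Irrationality.BrownZudilin2022 (vwpDual)

/-! ### The term as explicit binomials and Stirling -/

/-- The denominator binomials of the term, explicitly (`n ≥ 1`). -/
theorem prod_choose_h1E0 {n : ℕ} (hn1 : 1 ≤ n) (μ : ℕ) :
    (∏ j ∈ range 7, (((34 * n - BH1E 0 n j + μ + 1).choose (BH1E 0 n j + μ) : ℕ) : ℝ)) =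
      ((20 * n + μ + 1).choose (14 * n + μ) : ℝ)
        * ((21 * n + μ + 1).choose (13 * n + μ) : ℝ)
        * ((22 * n + μ + 1).choose (12 * n + μ) : ℝ)
        * ((23 * n + μ + 1).choose (11 * n + μ) : ℝ)
        * ((24 * n + μ + 1).choose (10 * n + μ) : ℝ)
        * ((25 * n + μ + 1).choose (9 * n + μ) : ℝ)
        * ((26 * n + μ + 1).choose (8 * n + μ) : ℝ) := by
  have hs0 : 34 * n - 14 * n + μ + 1 = 20 * n + μ + 1 := by omega
  have hs1 : 34 * n - 13 * n + μ + 1 = 21 * n + μ + 1 := by omega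
  have hs2 : 34 * n - 12 * n + μ + 1 = 22 * n + μ + 1 := by omega
  have hs3 : 34 * n - 11 * n + μ + 1 = 23 * n + μ + 1 := by omega
  have hs4 : 34 * n - 10 * n + μ + 1 = 24 * n + μ + 1 := by omega
  have hs5 : 34 * n - 9 * n + μ + 1 = 25 * n + μ + 1 := by omega
  have hs6 : 34 * n - 8 * n + μ + 1 = 26 * n + μ + 1 := by omega
  simp only [prod_range_succ, prod_range_zero, one_mul, add_zero, BH1E_val0, BH1E_val1, BH1E_val2, BH1E_val3, BH1E_val4, BH1E_val5, BH1E_val6, hs0, hs1, hs2, hs3, hs4, hs5, hs6]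

/-- **Stirling on the term**: `log T̂(μ) ≤ log(34n+2μ+2) + H(n,μ) + ½Σ_j log m_j + 14` (`n ≥ 1`). -/
theorem log_termHat_h1E0_le {n : ℕ} (hn1 : 1 ≤ n) (μ : ℕ) :
    Real.log (termHat (34 * n) (BH1E 0 n) μ) ≤ Real.log (34 * n + 2 * μ + 2) + Hh1E0 n μ
      + (Real.log (20 * n + μ + 1) + Real.log (21 * n + μ + 1) + Real.log (22 * n + μ + 1) + Real.log (23 * n + μ + 1) + Real.log (24 * n + μ + 1) + Real.log (25 * n + μ + 1) + Real.log (26 * n + μ + 1)) / 2 + 14 := by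
  unfold termHat
  rw [prod_choose_h1E0 hn1]
  have c0 : (0 : ℝ) < ((34 * n + μ + 1).choose μ : ℝ) := by exact_mod_cast Nat.choose_pos (by omega)
  have c1 : (0 : ℝ) < ((20 * n + μ + 1).choose (14 * n + μ) : ℝ) := by exact_mod_cast Nat.choose_pos (by omega)
  have c2 : (0 : ℝ) < ((21 * n + μ + 1).choose (13 * n + μ) : ℝ) := by exact_mod_cast Nat.choose_pos (by omega)
  have c3 : (0 : ℝ) < ((22 * n + μ + 1).choose (12 * n + μ) : ℝ) := by exact_mod_cast Nat.choose_pos (by omega)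
  have c4 : (0 : ℝ) < ((23 * n + μ + 1).choose (11 * n + μ) : ℝ) := by exact_mod_cast Nat.choose_pos (by omega)
  have c5 : (0 : ℝ) < ((24 * n + μ + 1).choose (10 * n + μ) : ℝ) := by exact_mod_cast Nat.choose_pos (by omega)
  have c6 : (0 : ℝ) < ((25 * n + μ + 1).choose (9 * n + μ) : ℝ) := by exact_mod_cast Nat.choose_pos (by omega)
  have c7 : (0 : ℝ) < ((26 * n + μ + 1).choose (8 * n + μ) : ℝ) := by exact_mod_cast Nat.choose_pos (by omega)
  have hA : (0 : ℝ) < ((34 * n + 2 * μ + 2 : ℕ) : ℝ) := by positivity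
  rw [Real.log_div (by positivity) (by positivity), Real.log_mul hA.ne' c0.ne',
    Real.log_mul (by positivity) c7.ne', Real.log_mul (by positivity) c6.ne', Real.log_mul (by positivity) c5.ne',
    Real.log_mul (by positivity) c4.ne', Real.log_mul (by positivity) c3.ne', Real.log_mul c1.ne' c2.ne']
  have u0 := log_choose_le_ent (show μ ≤ 34 * n + μ + 1 by omega)
  have l1 := ent_le_log_choose (show 1 ≤ 20 * n + μ + 1 by omega) (show 14 * n + μ ≤ 20 * n + μ + 1 by omega)
  have l2 := ent_le_log_choose (show 1 ≤ 21 * n + μ + 1 by omega) (show 13 * n + μ ≤ 21 * n + μ + 1 by omega)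
  have l3 := ent_le_log_choose (show 1 ≤ 22 * n + μ + 1 by omega) (show 12 * n + μ ≤ 22 * n + μ + 1 by omega)
  have l4 := ent_le_log_choose (show 1 ≤ 23 * n + μ + 1 by omega) (show 11 * n + μ ≤ 23 * n + μ + 1 by omega)
  have l5 := ent_le_log_choose (show 1 ≤ 24 * n + μ + 1 by omega) (show 10 * n + μ ≤ 24 * n + μ + 1 by omega)
  have l6 := ent_le_log_choose (show 1 ≤ 25 * n + μ + 1 by omega) (show 9 * n + μ ≤ 25 * n + μ + 1 by omega)
  have l7 := ent_le_log_choose (show 1 ≤ 26 * n + μ + 1 by omega) (show 8 * n + μ ≤ 26 * n + μ + 1 by omega)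
  push_cast at u0 l1 l2 l3 l4 l5 l6 l7 ⊢
  unfold Hh1E0
  linarith

/-! ### The window bound and the global bound -/

/-- **Window bound**: for `n ≥ 100`, `9n ≤ 50(μ+1)`, `5μ ≤ 1n + 5`: `T̂(μ) ≤ W_n`. -/
theorem termHat_h1E0_window_le {n μ : ℕ} (hn : 100 ≤ n) (hlo : 9 * n ≤ 50 * (μ + 1)) (hhi : 5 * μ ≤ 1 * n + 5) :
    termHat (34 * n) (BH1E 0 n) μ ≤ Wnh1 n := by
  have hn1 : 1 ≤ n := by omega
  have hT := termHat_pos (B₀ := 34 * n) (hreg_h1E (e := 0) (by norm_num) hn1) μ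
  rw [Wnh1, ← Real.exp_log hT]
  apply Real.exp_le_exp.mpr
  have h1 := log_termHat_h1E0_le hn1 μ
  have hn' : (100 : ℝ) ≤ n := by exact_mod_cast hn
  have hlo' : (9 : ℝ) * n ≤ 50 * (μ + 1) := by exact_mod_cast hlo
  have hhi' : (5 : ℝ) * μ ≤ 1 * n + 5 := by exact_mod_cast hhi
  have h2 := Hh1E0_window_bound (n := (n : ℝ)) (μ := (μ : ℝ)) hn' (by linarith) (by linarith)
  have hμ0 : (0 : ℝ) ≤ μ := Nat.cast_nonneg μ
  have m0 : Real.log (34 * n + 2 * μ + 2) ≤ Real.log (35 * n + 4) := Real.log_le_log (by positivity) (by linarith)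
  have m1 : Real.log (20 * n + μ + 1) ≤ Real.log (35 * n + 4) := Real.log_le_log (by positivity) (by linarith)
  have m2 : Real.log (21 * n + μ + 1) ≤ Real.log (35 * n + 4) := Real.log_le_log (by positivity) (by linarith)
  have m3 : Real.log (22 * n + μ + 1) ≤ Real.log (35 * n + 4) := Real.log_le_log (by positivity) (by linarith)
  have m4 : Real.log (23 * n + μ + 1) ≤ Real.log (35 * n + 4) := Real.log_le_log (by positivity) (by linarith)
  have m5 : Real.log (24 * n + μ + 1) ≤ Real.log (35 * n + 4) := Real.log_le_log (by positivity) (by linarith)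
  have m6 : Real.log (25 * n + μ + 1) ≤ Real.log (35 * n + 4) := Real.log_le_log (by positivity) (by linarith)
  have m7 : Real.log (26 * n + μ + 1) ≤ Real.log (35 * n + 4) := Real.log_le_log (by positivity) (by linarith)
  linarith

/-- **Every normalised term is `≤ W_n`** (`n ≥ 100`): unimodality + the window bound. -/
theorem termHat_h1E0_le_W {n : ℕ} (hn : 100 ≤ n) (μ : ℕ) : termHat (34 * n) (BH1E 0 n) μ ≤ Wnh1 n := by
  have hn1 : 1 ≤ n := by omega
  have hlo2 : 9 * n ≤ 50 * (μloh1 n + 1) := by unfold μloh1; omega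
  have hhi2 : 1 * n ≤ 5 * μhih1 n := by unfold μhih1; omega
  have hhi1 : 5 * μhih1 n ≤ 1 * n + 4 := by unfold μhih1; omega
  have hlo1 : 50 * μloh1 n ≤ 9 * n - 1 := by unfold μloh1; omega
  rcases le_or_gt μ (μloh1 n) with hμ | hμ
  · have step : ∀ ν, ν < μloh1 n → termHat (34 * n) (BH1E 0 n) ν ≤ termHat (34 * n) (BH1E 0 n) (ν + 1) :=
      fun ν hν => termHat_h1_le_succ (by omega)
    exact (termHat_le_of_increasing step hμ).trans (termHat_h1E0_window_le hn hlo2 (by omega))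
  rcases le_or_gt μ (μhih1 n) with hμ' | hμ'
  · exact termHat_h1E0_window_le hn (by omega) (by omega)
  · have step : ∀ ν, μhih1 n ≤ ν → termHat (34 * n) (BH1E 0 n) (ν + 1) ≤ termHat (34 * n) (BH1E 0 n) ν :=
      fun ν hν => termHat_h1_succ_le (by omega)
    exact (termHat_le_of_decreasing step hμ'.le).trans (termHat_h1E0_window_le hn (by omega) (by omega))

/-- **Tail**: for `μ ≥ n` (`n ≥ 100`), `T̂(μ) ≤ W_n·((n+1)/(μ+1))²`. -/
theorem termHat_h1E0_tail_le_W {n μ : ℕ} (hn : 100 ≤ n) (hμ : n ≤ μ) :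
    termHat (34 * n) (BH1E 0 n) μ ≤ Wnh1 n * (((n : ℝ) + 1) / ((μ : ℝ) + 1)) ^ 2 := by
  have hn1 : 1 ≤ n := by omega
  have h := termHat_le_of_tail (B₀ := 34 * n) (B := BH1E 0 n) (μ₃ := n) (fun ν hν => termHat_h1_tail hν) hμ
  have hW := termHat_h1E0_le_W hn n
  have h0 : 0 ≤ (((n : ℝ) + 1) / ((μ : ℝ) + 1)) ^ 2 := by positivity
  exact h.trans (mul_le_mul_of_nonneg_right hW h0)

/-- **Partial sums**: `Σ_{μ<N} T̂(μ) ≤ 2(n+1)·W_n` for every `N` (`n ≥ 100`). -/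
theorem partial_sums_h1E0_le {n : ℕ} (hn : 100 ≤ n) (N : ℕ) :
    ∑ μ ∈ range N, termHat (34 * n) (BH1E 0 n) μ ≤ 2 * ((n : ℝ) + 1) * Wnh1 n := by
  have hn1 : 1 ≤ n := by omega
  have hW0 : 0 ≤ Wnh1 n := (Real.exp_pos _).le
  have hT0 : ∀ μ, 0 ≤ termHat (34 * n) (BH1E 0 n) μ :=
    fun μ => (termHat_pos (B₀ := 34 * n) (hreg_h1E (e := 0) (by norm_num) hn1) μ).le
  rcases le_or_gt N (n + 1) with hN | hN
  · calc ∑ μ ∈ range N, termHat (34 * n) (BH1E 0 n) μ ≤ ∑ _μ ∈ range N, Wnh1 n :=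
          sum_le_sum fun μ _ => termHat_h1E0_le_W hn μ
      _ = N * Wnh1 n := by rw [sum_const, card_range, nsmul_eq_mul]
      _ ≤ 2 * ((n : ℝ) + 1) * Wnh1 n := by
          have : (N : ℝ) ≤ n + 1 := by exact_mod_cast hN
          nlinarith
  · have key : ∀ N, n + 1 ≤ N → ∑ μ ∈ range N, termHat (34 * n) (BH1E 0 n) μ ≤
        ((n : ℝ) + 1) * Wnh1 n + Wnh1 n * ((n : ℝ) + 1) ^ 2 * (1 / ((n : ℝ) + 1) - 1 / (N : ℝ)) := by
      intro N hN
      induction N, hN using Nat.le_induction with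
      | base =>
        have h1 : ∑ μ ∈ range (n + 1), termHat (34 * n) (BH1E 0 n) μ ≤ ((n : ℝ) + 1) * Wnh1 n := by
          calc ∑ μ ∈ range (n + 1), termHat (34 * n) (BH1E 0 n) μ ≤ ∑ _μ ∈ range (n + 1), Wnh1 n :=
                sum_le_sum fun μ _ => termHat_h1E0_le_W hn μ
            _ = ((n : ℝ) + 1) * Wnh1 n := by rw [sum_const, card_range, nsmul_eq_mul]; push_cast; ring
        have h2 : (1 / ((n : ℝ) + 1) - 1 / ((n + 1 : ℕ) : ℝ)) = 0 := by push_cast; ring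
        rw [h2]; linarith
      | succ N hN ih =>
        rw [sum_range_succ]
        have hNpos : (0 : ℝ) < N := by exact_mod_cast (show 0 < N by omega)
        have ht := termHat_h1E0_tail_le_W hn (show n ≤ N by omega)
        have hsq : (((n : ℝ) + 1) / ((N : ℝ) + 1)) ^ 2 ≤ ((n : ℝ) + 1) ^ 2 * (1 / (N : ℝ) - 1 / ((N : ℝ) + 1)) := by
          rw [div_pow]
          have e : 1 / (N : ℝ) - 1 / ((N : ℝ) + 1) = 1 / ((N : ℝ) * ((N : ℝ) + 1)) := by field_simp; ring
          rw [e, ← div_eq_mul_one_div]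
          apply div_le_div_of_nonneg_left (by positivity) (by positivity)
          nlinarith
        have hstep : termHat (34 * n) (BH1E 0 n) N ≤ Wnh1 n * ((n : ℝ) + 1) ^ 2 * (1 / (N : ℝ) - 1 / ((N : ℝ) + 1)) := by
          calc termHat (34 * n) (BH1E 0 n) N ≤ Wnh1 n * (((n : ℝ) + 1) / ((N : ℝ) + 1)) ^ 2 := ht
            _ ≤ Wnh1 n * (((n : ℝ) + 1) ^ 2 * (1 / (N : ℝ) - 1 / ((N : ℝ) + 1))) := mul_le_mul_of_nonneg_left hsq hW0
            _ = _ := by ring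
        have hc : ((N + 1 : ℕ) : ℝ) = (N : ℝ) + 1 := by push_cast; ring
        rw [hc]
        linarith
    have h := key N hN.le
    have hNpos : (0 : ℝ) < N := by exact_mod_cast (show 0 < N by omega)
    have hinv : 0 ≤ 1 / (N : ℝ) := by positivity
    have hn1' : (0 : ℝ) < (n : ℝ) + 1 := by positivity
    have e : Wnh1 n * ((n : ℝ) + 1) ^ 2 * (1 / ((n : ℝ) + 1)) = ((n : ℝ) + 1) * Wnh1 n := by field_simp
    nlinarith [mul_nonneg (mul_nonneg hW0 (sq_nonneg ((n : ℝ) + 1))) hinv]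

/-! ### The upper bound for `F̃₇` and its rate -/

/-- **Upper bound**: `F̃₇(natB (34n) (BH1E 0 n)) ≤ Z·2(n+1)·W_n` (`n ≥ 100`). -/
theorem vwpDual_h1E0_upper {n : ℕ} (hn : 100 ≤ n) :
    vwpDual 7 (natB (34 * n) (BH1E 0 n)) ≤ termNorm (34 * n) (BH1E 0 n) * (2 * ((n : ℝ) + 1) * Wnh1 n) := by
  have hn1 : 1 ≤ n := by omega
  exact vwpDual_seven_le_of_partial_sums (hle_h1E (e := 0) (by norm_num) hn1) (hreg_h1E (e := 0) (by norm_num) hn1)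
    (hsum_h1E (e := 0) (by norm_num)) (partial_sums_h1E0_le hn)

/-- **Upper rate**: for every `ε > 0`, eventually `F̃₇ ≤ Z·e^{(-105.7485 + ε)·n}`. -/
theorem eventually_vwpDual_h1E0_le_exp {ε : ℝ} (hε : 0 < ε) :
    ∀ᶠ n : ℕ in atTop, vwpDual 7 (natB (34 * n) (BH1E 0 n)) ≤
      termNorm (34 * n) (BH1E 0 n) * Real.exp ((-211497 / 2000 + ε) * n) := by
  filter_upwards [eventually_ge_atTop 100,
    eventually_log_linear_le (a := 2) (b := 2) (by norm_num) (by norm_num) (show (0 : ℝ) < ε / 4 by positivity),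
    eventually_log_linear_le (a := 35) (b := 0) (by norm_num) le_rfl (show (0 : ℝ) < ε / 400 by positivity),
    eventually_log_linear_le (a := 35) (b := 4) (by norm_num) (by norm_num) (show (0 : ℝ) < ε / 20 by positivity),
    tendsto_natCast_atTop_atTop.eventually_ge_atTop (500 / ε)] with n hn h2 hM0 hM4 hbig
  refine (vwpDual_h1E0_upper hn).trans (mul_le_mul_of_nonneg_left ?_ (termNorm_pos _ _).le)
  have hW : 2 * ((n : ℝ) + 1) * Wnh1 n = Real.exp (Real.log (2 * n + 2) + ((n : ℝ) * (hhath1 + lambdaPlush1 * (1 / 50))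
      + 2 * lambdaPlush1 + 96 * (1 + Real.log (35 * n)) + 9 / 2 * Real.log (35 * n + 4) + 14)) := by
    rw [Real.exp_add, Real.exp_log (by positivity)]; unfold Wnh1; ring
  rw [hW]
  apply Real.exp_le_exp.mpr
  have hh := hhath1_le
  obtain ⟨lp0, lp1⟩ := lambdaPlush1_bounds
  have hn' : (0 : ℝ) ≤ n := Nat.cast_nonneg n
  rw [add_zero] at hM0
  have hc : (500 : ℝ) ≤ ε * n := by rwa [div_le_iff₀ hε, mul_comm] at hbig
  nlinarith

end Summit.KontsevichZagierPeriods.Zeta5Search.RayH1
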